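import Summits.BirchSwinnertonDyer.BirchSwinnertonDyer.Theorems.GenusKolyvaginAtTwoMinimalTwinBSDTwoRankOneTransfer
import HarnessLib

/-!
# Rung K4 leaf `NonCMAtTwo`, rank-one transfer — THE ∃-FORM IDX∃ (the weakest research stub): the rank-one half of the leaf ⟸ rank-zero wall + IDX∃ +
# PRINT with NO Friedberg–Hoffstein input; FH moves to the lossless direction; modulo PRINT + FH, `NonCMAtTwo ⟺ rank-zero wall ∧ IDX∃`

Seat `bsd-line-gk2-p2` g27 (PROVER seat 2/3, cell `bsd-f1-sign2`, LINE 23 holder on U₂ stmt-BirchSwinnertonDyer-22985), `--supports stmt-BirchSwinnertonDyer-22985`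
(helper; closes nothing).  THEOREMS ONLY; standard axioms.  **BSD is NOT proved by this file; nothing is closed.**  Companion of `RankOneTransfer` (p788609):
there IDX is a ∀-statement over all Friedberg–Hoffstein frames and all Heegner data; since the transfer uses ONE frame, the research content can be stated
in its weakest form IDX∃ = «for every non-CM globally minimal `W` with `r_an = 1` there EXIST an imaginary quadratic `K` (`d_K < −4`, Heegner for `N_W`, `2` split,
`L(W^{(d_K)},1) ≠ 0`), a datum, a Heegner datum, an embedding and a Heegner point `P ∈ W(K)` with `#Ш(W_K)[2^∞] · 4^{ord₂ c + ord₂ C(W)} = 4^{ord₂ [W(K):ℤP]}`»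
(a prover may CHOOSE the field and the datum):
* ★ `bsdp_rankOne_of_wall_of_idxExists_of_facts` — rank-one BSD₂ (non-CM) ⟸ S1′ + IDX∃ + PRINT (no FH);
* ★ `idxExists_of_bsdp_rankLeOne_of_friedbergHoffstein_of_facts` — LOSSLESS given FH: BSD₂ (non-CM, `r_an ≤ 1`) + PRINT + FH ⟹ IDX∃;
* ★ `nonCMAtTwo_iff_rankZero_and_idxExists_of_facts` — modulo PRINT + FH: `Rank1Residual.NonCMAtTwo ↔ S1′ ∧ IDX∃`.
References: [GrossZagier1986] V.§2 (2.2); [FriedbergHoffstein1995] main theorem; [Milne1972ArithmeticAV] §1 Thm. 1; [BCDTJAMS2001] Thm. A; [Miller2011LMS] Def. 1.1.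
-/

set_option autoImplicit false
set_option linter.dupNamespace false -- `Summit.<P>.<Sub>` repeats `BirchSwinnertonDyer` (D-0017)

noncomputable section

open scoped Classical

open WeierstrassCurve NumberField Literature.NumberTheory.EllipticCurves
  Literature.NumberTheory.EllipticCurves.ModularForms
  Literature.NumberTheory.EllipticCurves.Rank1Residual
  Literature.NumberTheory.EllipticCurves.Rank1Residual.Typed
  Literature.NumberTheory.EllipticCurves.KrizLi2019
  Summit.BirchSwinnertonDyer.Rank1Residual
  Summit.BirchSwinnertonDyer.Rank1Residual.AdditivePotMult
  Summit.BirchSwinnertonDyer.BirchSwinnertonDyer.Rank1Residual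
  Summit.BirchSwinnertonDyer.BirchSwinnertonDyer.Theorems.CMExactDescent
  Summit.BirchSwinnertonDyer.BirchSwinnertonDyer.Theorems.GenusExact.TwinSwap
  Summit.BirchSwinnertonDyer.BirchSwinnertonDyer.Theorems.GenusExact.TwinSwap.IdentityDoor

open Summit.BirchSwinnertonDyer.BirchSwinnertonDyer.Theorems.GenusExact.TwinSwap.Ledger.Line25
  (exists_kolyvaginHeegnerData_one_of_nonempty_modularParametrizationData)
open Summit.BirchSwinnertonDyer.BirchSwinnertonDyer.Theorems.GenusExact.TwinSwap.RankOneTransfer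
  (missingPPartOverCAt_baseChange_of_idx idx_of_bsdp_rankLeOne_of_facts)

namespace Summit.BirchSwinnertonDyer.BirchSwinnertonDyer.Theorems.GenusExact.TwinSwap.RankOneTransferExists

/-- ★ **THE RANK-ONE TRANSFER FROM THE ∃-FORM: BSD₂ for EVERY non-CM globally minimal `W` with `r_an = 1` ⟸ S1′ + IDX∃ + PRINT — NO Friedberg–Hoffstein
input.**  IDX∃ = «for every such `W` there EXIST an imaginary quadratic `K` (`d_K < −4`, Heegner for `N_W`, `2` split, `L(W^{(d_K)},1) ≠ 0`), a datum, a Heegner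
datum, an embedding and `P ∈ W(K)` over the complex Heegner point WITH `#Ш(W_K)[2^∞] · 2^{2(ord₂ c + ord₂ C(W))} = 2^{2 ord₂ [W(K):ℤP]}`» — the weakest form of
the research content (a prover may CHOOSE the field and the datum).  Proof: Néron minimal model of the twist, non-CM of analytic rank `0`, `BSD₂` by S1′; §1;
Milne any model.  CONDITIONAL; proves nothing about BSD; closes nothing.  [cite: GrossZagier1986, V.§2 (2.2)] [cite: Milne1972ArithmeticAV, §1 Thm. 1]
[cite: SilvermanAEC2009, VIII.8 Cor. 8.3] -/
theorem bsdp_rankOne_of_wall_of_idxExists_of_facts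
    (hGZ : ∀ (N : ℕ) [NeZero N] (W : WeierstrassCurve ℚ) (K : Type) [Field K] [NumberField K], gross_zagier N W K)
    (hGZK : rank_eq_analyticRank_of_analyticRank_le_one) (hmod : hasEntireLFunction_rat)
    (hMilneC : Milne1972.bsdQuotient_baseChange_quadratic_anyModel)
    (hS1 : ∀ (W : WeierstrassCurve ℚ) [W.IsElliptic] [W.IsGloballyMinimal], ¬ W.HasCM → W.analyticRank = 0 → BSDp W 2)
    (hIDX : ∀ (W : WeierstrassCurve ℚ) [W.IsElliptic] [W.IsGloballyMinimal] [NeZero (W.conductorNorm ℤ)],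
      ¬ W.HasCM → W.analyticRank = 1 →
      ∃ (K : Type) (_ : Field K) (_ : NumberField K), IsImaginaryQuadratic K ∧ NumberField.discr K < -4 ∧
        SatisfiesHeegnerHypothesis (W.conductorNorm ℤ) K ∧ SatisfiesHeegnerHypothesis 2 K ∧
        (W.quadraticTwist (NumberField.discr K : ℚ)).entireLFunction 1 ≠ 0 ∧
        ∃ (Dt : ModularParametrizationData W (W.conductorNorm ℤ)) (H : HeegnerDatum (W.conductorNorm ℤ) (NumberField.discr K))
          (ι : K →+* ℂ) (P : (W.baseChange K).toAffine.Point),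
          WeierstrassCurve.Affine.Point.map ι.toRatAlgHom P = heegnerPointComplex Dt H ∧
          Nat.card (AddCommGroup.primaryComponent (W.baseChange K).sha 2) *
              2 ^ (2 * (padicValInt 2 Dt.c + padicValNat 2 W.tamagawaProduct)) =
            2 ^ (2 * padicValNat 2 (AddSubgroup.zmultiples P).index)) :
    ∀ (W : WeierstrassCurve ℚ) [W.IsElliptic] [W.IsGloballyMinimal], ¬ W.HasCM → W.analyticRank = 1 → BSDp W 2 := by
  intro W _ _ hcm hr
  haveI : NeZero (W.conductorNorm ℤ) := ⟨(W.conductorNorm_pos_holds).ne'⟩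
  obtain ⟨K, _, _, hK, hlt, hH, -, hL, Dt, H, ι, P, hP, hidx⟩ := hIDX W hcm hr
  have h2 : Module.finrank ℚ K = 2 := hK.1
  have hD0 : (NumberField.discr K : ℚ) ≠ 0 := by exact_mod_cast NumberField.discr_ne_zero K
  haveI := W.isElliptic_quadraticTwist hD0
  obtain ⟨Cd, hmin⟩ := hasGlobalMinimalModel_rat_holds (W.quadraticTwist (NumberField.discr K : ℚ))
  haveI := hmin
  have hcmd : ¬ (Cd • W.quadraticTwist (NumberField.discr K : ℚ)).HasCM := by
    rw [hasCM_iff_of_j_eq (((W.quadraticTwist (NumberField.discr K : ℚ)).variableChange_j Cd).trans (W.j_quadraticTwist hD0))]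
    exact hcm
  have hrd : (Cd • W.quadraticTwist (NumberField.discr K : ℚ)).analyticRank = 0 := by
    rw [analyticRank_smul]
    exact ((W.quadraticTwist (NumberField.discr K : ℚ)).analyticRank_eq_zero_iff_holds (hmod _)).mpr hL
  have hBd : BSDp (Cd • W.quadraticTwist (NumberField.discr K : ℚ)) 2 := hS1 _ hcmd hrd
  obtain ⟨hKin, -, -⟩ := missingPPartOverCAt_baseChange_of_idx W K (hGZ _ W K) hGZK hmod hr hK hlt hH hL Dt H ι P hP hidx
  exact bsdp_of_pPartOverC_baseChange W 2 K (Cd • W.quadraticTwist (NumberField.discr K : ℚ)) hGZK hmod hMilneC (le_of_eq hr) h2 ⟨Cd, rfl⟩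
    (by rw [hrd]; exact zero_le_one) hKin hBd

/-- ★ **IDX∃ IS LOSSLESS given Friedberg–Hoffstein: BSD₂ for non-CM curves of analytic rank ≤ 1 + PRINT + FH ⟹ IDX∃.**  Parity ⟹ `w(W) = −1`; FH supplies the
frame; BCDT a datum, the tree a Heegner point over `K`; §3 (the ∀-form losslessness) gives the relation there.  CONDITIONAL; proves nothing about BSD.
[cite: FriedbergHoffstein1995, main theorem] [cite: GrossZagier1986, V.§2 (2.2)] [cite: BCDTJAMS2001, Thm. A] -/
theorem idxExists_of_bsdp_rankLeOne_of_friedbergHoffstein_of_facts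
    (hGZ : ∀ (N : ℕ) [NeZero N] (W : WeierstrassCurve ℚ) (K : Type) [Field K] [NumberField K], gross_zagier N W K)
    (hGZK : rank_eq_analyticRank_of_analyticRank_le_one) (hmod : hasEntireLFunction_rat)
    (hMilneC : Milne1972.bsdQuotient_baseChange_quadratic_anyModel) (hMP : nonempty_modularParametrizationData)
    (hFH : friedbergHoffstein_exists_heegnerField_split_twist_ne_zero)
    (hS1 : ∀ (W : WeierstrassCurve ℚ) [W.IsElliptic] [W.IsGloballyMinimal], ¬ W.HasCM → W.analyticRank = 0 → BSDp W 2)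
    (hR1 : ∀ (W : WeierstrassCurve ℚ) [W.IsElliptic] [W.IsGloballyMinimal], ¬ W.HasCM → W.analyticRank = 1 → BSDp W 2) :
    ∀ (W : WeierstrassCurve ℚ) [W.IsElliptic] [W.IsGloballyMinimal] [NeZero (W.conductorNorm ℤ)],
      ¬ W.HasCM → W.analyticRank = 1 →
      ∃ (K : Type) (_ : Field K) (_ : NumberField K), IsImaginaryQuadratic K ∧ NumberField.discr K < -4 ∧
        SatisfiesHeegnerHypothesis (W.conductorNorm ℤ) K ∧ SatisfiesHeegnerHypothesis 2 K ∧
        (W.quadraticTwist (NumberField.discr K : ℚ)).entireLFunction 1 ≠ 0 ∧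
        ∃ (Dt : ModularParametrizationData W (W.conductorNorm ℤ)) (H : HeegnerDatum (W.conductorNorm ℤ) (NumberField.discr K))
          (ι : K →+* ℂ) (P : (W.baseChange K).toAffine.Point),
          WeierstrassCurve.Affine.Point.map ι.toRatAlgHom P = heegnerPointComplex Dt H ∧
          Nat.card (AddCommGroup.primaryComponent (W.baseChange K).sha 2) *
              2 ^ (2 * (padicValInt 2 Dt.c + padicValNat 2 W.tamagawaProduct)) =
            2 ^ (2 * padicValNat 2 (AddSubgroup.zmultiples P).index) := by
  intro W _ _ _ hcm hr
  -- `w(W) = −1` by parity; a Friedberg–Hoffstein field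
  obtain ⟨Dt₀⟩ := hMP W
  have hw : W.rootNumber = -1 := by
    rcases Literature.NumberTheory.EllipticCurves.rootNumber_eq_one_or_eq_neg_one W with h1 | h1
    · exfalso
      have hev : Even W.analyticRank :=
        (Literature.Barriers.BirchSwinnertonDyer.even_analyticRank_iff_of_isNewformOf_conductorLevel Dt₀.isNewformOf).mpr h1
      rw [hr] at hev
      exact Nat.not_even_one hev
    · exact h1
  obtain ⟨K, _, _, hK, hB, hH, h2H, hL⟩ := hFH W hw 2 Nat.prime_two 4
  have hlt : NumberField.discr K < -4 := by
    have hneg := hK.discr_neg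
    omega
  -- a datum and a Heegner point over `K`
  obtain ⟨Dt, β, ι, d₁, -⟩ := exists_kolyvaginHeegnerData_one_of_nonempty_modularParametrizationData hMP W K hK hH
  obtain ⟨P, H, hP, -⟩ := exists_heegnerPoint_map_eq_derivedPoint_one hK hH d₁
  exact ⟨K, inferInstance, inferInstance, hK, hlt, hH, h2H, hL, Dt, H, ι, P, hP,
    idx_of_bsdp_rankLeOne_of_facts hGZ hGZK hmod hMilneC hS1 hR1 W hcm hr K hK hlt hH h2H hL Dt H ι P hP⟩

/-- ★ **THE LEAF WITH THE ∃-FORM: modulo PRINT + Friedberg–Hoffstein, `Rank1Residual.NonCMAtTwo ↔ S1′ ∧ IDX∃`** — the K4 leaf is the rank-zero wall plus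
«every non-CM rank-one curve has SOME Heegner frame at which the 2-primary Gross–Zagier index relation holds».  CENSUS statement; nothing about BSD is proved.
[cite: GrossZagier1986, V.§2 (2.2)] [cite: FriedbergHoffstein1995, main theorem] [cite: Miller2011LMS, Def. 1.1] -/
theorem nonCMAtTwo_iff_rankZero_and_idxExists_of_facts
    (hGZ : ∀ (N : ℕ) [NeZero N] (W : WeierstrassCurve ℚ) (K : Type) [Field K] [NumberField K], gross_zagier N W K)
    (hGZK : rank_eq_analyticRank_of_analyticRank_le_one) (hmod : hasEntireLFunction_rat)
    (hMilneC : Milne1972.bsdQuotient_baseChange_quadratic_anyModel) (hMP : nonempty_modularParametrizationData)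
    (hFH : friedbergHoffstein_exists_heegnerField_split_twist_ne_zero) :
    Summit.BirchSwinnertonDyer.BirchSwinnertonDyer.Rank1Residual.NonCMAtTwo ↔
      ((∀ (W : WeierstrassCurve ℚ) [W.IsElliptic] [W.IsGloballyMinimal], ¬ W.HasCM → W.analyticRank = 0 → BSDp W 2) ∧
      ∀ (W : WeierstrassCurve ℚ) [W.IsElliptic] [W.IsGloballyMinimal] [NeZero (W.conductorNorm ℤ)],
      ¬ W.HasCM → W.analyticRank = 1 →
      ∃ (K : Type) (_ : Field K) (_ : NumberField K), IsImaginaryQuadratic K ∧ NumberField.discr K < -4 ∧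
        SatisfiesHeegnerHypothesis (W.conductorNorm ℤ) K ∧ SatisfiesHeegnerHypothesis 2 K ∧
        (W.quadraticTwist (NumberField.discr K : ℚ)).entireLFunction 1 ≠ 0 ∧
        ∃ (Dt : ModularParametrizationData W (W.conductorNorm ℤ)) (H : HeegnerDatum (W.conductorNorm ℤ) (NumberField.discr K))
          (ι : K →+* ℂ) (P : (W.baseChange K).toAffine.Point),
          WeierstrassCurve.Affine.Point.map ι.toRatAlgHom P = heegnerPointComplex Dt H ∧
          Nat.card (AddCommGroup.primaryComponent (W.baseChange K).sha 2) *
              2 ^ (2 * (padicValInt 2 Dt.c + padicValNat 2 W.tamagawaProduct)) =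
            2 ^ (2 * padicValNat 2 (AddSubgroup.zmultiples P).index)) := by
  refine ⟨fun h ↦ ?_, fun ⟨hS1, hIDX⟩ W _ _ hcm hr ↦ ?_⟩
  · have hS1 : ∀ (W : WeierstrassCurve ℚ) [W.IsElliptic] [W.IsGloballyMinimal], ¬ W.HasCM → W.analyticRank = 0 → BSDp W 2 :=
      fun W _ _ hcm hr0 ↦ h W hcm (by rw [hr0]; exact zero_le_one)
    exact ⟨hS1, idxExists_of_bsdp_rankLeOne_of_friedbergHoffstein_of_facts hGZ hGZK hmod hMilneC hMP hFH hS1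
      fun W _ _ hcm hr1 ↦ h W hcm (le_of_eq hr1)⟩
  · rcases Nat.le_one_iff_eq_zero_or_eq_one.mp hr with hr0 | hr1
    · exact hS1 W hcm hr0
    · exact bsdp_rankOne_of_wall_of_idxExists_of_facts hGZ hGZK hmod hMilneC hS1 hIDX W hcm hr1

end Summit.BirchSwinnertonDyer.BirchSwinnertonDyer.Theorems.GenusExact.TwinSwap.RankOneTransferExists

end
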